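import Summits.Ventures.DiscreteObjects.Hadamard.OrbitRepsPMTools
import Summits.Ventures.DiscreteObjects.Hadamard.ResignOddOrder
import Summits.Ventures.DiscreteObjects.Hadamard.GSRowSums167

/-!
# Cyclic cores: a free row of a Hadamard matrix with a cyclic automorphism gives `±1` sequences with prescribed
# autocorrelation sum (kernel, general) — the automorphism ⇒ sequence-family dictionary

Framing: lottery ticket; floor = certified bounds/negative ranges.

Cell pub-namedobj (venture DiscreteObjects), target (H), hadamard gen 19.  Let `H` be a Hadamard matrix (any order `N`) with a
permutation automorphism pair `(π, κ)` (`H (π i) (κ j) = H i j`), `π ^ n = κ ^ n = 1`, such that every column is either FIXED by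
`κ` or FREE of period `n` (`κ^k y ≠ y` for `0 < k < n`), and let `x₀` be a row free of period `n` under `π`.  Choose a
transversal `T` of the free columns (`exists_free_transversal`: `n·|T| = #free`, and `Σ_free f = Σ_{y∈T} Σ_{k<n} f (κ^k y)` for
EVERY `f`).  Then for every `0 < s < n` (**`cyclicCore_paf_identity`**)
`Σ_{y∈T} Σ_{k<n} H x₀ (κ^k y) · H x₀ (κ^(k+s) y) = − #Fix κ`:
indeed `H x₀ (κ^(k+s) y) = H x₁ (κ^k y)` with `x₁ = π^(n−s) x₀ ≠ x₀`, the double sum is the inner product of rows `x₀, x₁` over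
the free columns, the full inner product vanishes, and on a fixed column the two rows agree.  Read on `ZMod n`
(**`exists_paf_family`**, **`exists_paf_family_signed`** after re-signing a SIGNED automorphism of odd order along its cycles,
`exists_resign_of_odd`): the `|T|` sequences `t ↦ H x₀ (κ^t y)` (`y ∈ T`) are `±1` and their periodic autocorrelations
satisfy `Σ_{y∈T} PAF (s) = − #Fix κ` for every `s ≠ 0`.  This is the dictionary between the cyclic-automorphism census of a
putative H(668) and PLAN-H's sequence families: order `167` (no fixed column, `|T| = 4`) gives a Goethals–Seidel quadruple
over `ZMod 167` (family F2), order `333` (`2` fixed, `|T| = 2`) a Legendre pair of length `333` (family F3), orders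
`37 / 83 / 41 / 111` give `18 / 8 / 16 / 6` sequences with autocorrelation sum `−2 / −4 / −12 / −2` (files `Order167GSQuad668`,
`Order333LegendrePair668`, `CyclicCoreDictionary668`).  The array ⇔ sequence direction is classical (a matrix with a regular
cyclic action on rows and columns is circulant: Horadam 2007 §2.3; Goethals–Seidel 1970; Fletcher–Gysin–Seberry 2001); the
statements here are ours, elementary, no `sorry`, no definitions.
-/

namespace Summit.Ventures.DiscreteObjects.Hadamard

open Finset BigOperators Matrix

open Literature.Combinatorics.Designs.GoethalsSeidel (IsHadamardMatrix)
open Literature.Combinatorics.Designs.LegendrePairs (PAF IsPM)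

variable {ι : Type*} [DecidableEq ι]

/-! ### a transversal of the free orbits, with the orbit decomposition of arbitrary sums -/

/-- **Free transversal.**  If `Y` is `κ`-stable and every point of `Y` satisfies `(κ^n) y = y` and is free below `n`, there is
`T ⊆ Y` with `n·|T| = |Y|` and `Σ_{y∈Y} f y = Σ_{t∈T} Σ_{k<n} f (κ^k t)` for EVERY `f` (cf. `exists_orbit_reps`, which records
the sum only for `κ`-invariant `f`). -/
lemma exists_free_transversal (κ : Equiv.Perm ι) {n : ℕ} (hn : 0 < n) :
    ∀ (N : ℕ) (Y : Finset ι), Y.card ≤ N → (∀ y ∈ Y, κ y ∈ Y) → (∀ y ∈ Y, (κ ^ n) y = y) →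
      (∀ y ∈ Y, ∀ k, 0 < k → k < n → (κ ^ k) y ≠ y) →
      ∃ T : Finset ι, T ⊆ Y ∧ n * T.card = Y.card ∧
        ∀ f : ι → ℤ, ∑ y ∈ Y, f y = ∑ t ∈ T, ∑ k ∈ Finset.range n, f ((κ ^ k) t) := by
  intro N
  induction N with
  | zero =>
    intro Y hY _ _ _
    refine ⟨∅, Finset.empty_subset _, ?_, fun f => ?_⟩
    · rw [Finset.card_eq_zero.mp (Nat.le_zero.mp hY)]; simp
    · rw [Finset.card_eq_zero.mp (Nat.le_zero.mp hY)]; simp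
  | succ N ih =>
    intro Y hY hstab hper hfree
    rcases Y.eq_empty_or_nonempty with hYe | ⟨y, hy⟩
    · refine ⟨∅, Finset.empty_subset _, ?_, fun f => ?_⟩
      · rw [hYe]; simp
      · rw [hYe]; simp
    · have hO : orbFin κ n y ⊆ Y := orbFin_subset_of_stable Y hstab hy
      have hOc : (orbFin κ n y).card = n := card_orbFin_of_free (hfree y hy)
      have hcard : (Y \ orbFin κ n y).card + n = Y.card := by
        have h := Finset.card_sdiff_add_card_eq_card hO
        rw [hOc] at h
        exact h
      have hstab' : ∀ z ∈ Y \ orbFin κ n y, κ z ∈ Y \ orbFin κ n y := by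
        intro z hz
        rw [Finset.mem_sdiff] at hz ⊢
        refine ⟨hstab z hz.1, fun hκz => hz.2 ?_⟩
        have e : z = (κ ^ (n - 1)) (κ z) := by
          rw [← Equiv.Perm.mul_apply, ← pow_succ, Nat.sub_add_cancel hn, hper z hz.1]
        rw [e]
        obtain ⟨i, -, hi⟩ := Finset.mem_image.mp hκz
        rw [← hi, ← Equiv.Perm.mul_apply, ← pow_add]
        exact pow_apply_mem_orbFin_of_fixed κ hn (hper y hy) _
      have hper' : ∀ z ∈ Y \ orbFin κ n y, (κ ^ n) z = z := fun z hz => hper z (Finset.mem_sdiff.mp hz).1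
      have hfree' : ∀ z ∈ Y \ orbFin κ n y, ∀ k, 0 < k → k < n → (κ ^ k) z ≠ z :=
        fun z hz => hfree z (Finset.mem_sdiff.mp hz).1
      have hlt : (Y \ orbFin κ n y).card ≤ N := by omega
      obtain ⟨T', hT'sub, hT'card, hT'sum⟩ := ih (Y \ orbFin κ n y) hlt hstab' hper' hfree'
      have hyT' : y ∉ T' := by
        intro h
        have := hT'sub h
        rw [Finset.mem_sdiff] at this
        exact this.2 (mem_orbFin_self κ hn y)
      refine ⟨insert y T', ?_, ?_, fun f => ?_⟩
      · intro t ht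
        rcases Finset.mem_insert.mp ht with rfl | ht
        · exact hy
        · exact (Finset.mem_sdiff.mp (hT'sub ht)).1
      · rw [Finset.card_insert_of_notMem hyT', Nat.mul_succ, hT'card, hcard]
      · rw [← Finset.sum_sdiff hO, hT'sum f, sum_orbFin_of_free (hfree y hy) f, Finset.sum_insert hyT']
        ring

/-! ### the cyclic-core autocorrelation identity -/

variable [Fintype ι]

omit [DecidableEq ι] [Fintype ι] in
/-- iterating a permutation automorphism pair: `H (π^m i) (κ^m j) = H i j` -/
lemma perm_aut_pow {H : Matrix ι ι ℤ} {π κ : Equiv.Perm ι} (hinv : ∀ i j, H (π i) (κ j) = H i j) (m : ℕ) :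
    ∀ i j, H ((π ^ m) i) ((κ ^ m) j) = H i j := by
  induction m with
  | zero => intro i j; simp
  | succ m ih => intro i j; rw [pow_succ', pow_succ', Equiv.Perm.mul_apply, Equiv.Perm.mul_apply, hinv, ih]

/-- **Cyclic-core PAF identity.**  `H` Hadamard with a permutation automorphism pair `(π, κ)`, `π ^ n = 1`; `T` a finset whose
`κ`-cycles of length `n` list the moved columns exactly (`Σ_{κ y ≠ y} f y = Σ_{t∈T} Σ_{k<n} f (κ^k t)` for all `f`); `x₀` a row with
`π^k x₀ ≠ x₀` for `0 < k < n`.  Then for `0 < s < n`: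
`Σ_{t∈T} Σ_{k<n} H x₀ (κ^k t) · H x₀ (κ^(k+s) t) = −#{y : κ y = y}`. -/
theorem cyclicCore_paf_identity {H : Matrix ι ι ℤ} (hH : IsHadamardMatrix H) {π κ : Equiv.Perm ι}
    (hinv : ∀ i j, H (π i) (κ j) = H i j) {n : ℕ} (hπ : π ^ n = 1) (T : Finset ι)
    (hT : ∀ f : ι → ℤ, ∑ y ∈ univ.filter (fun y => κ y ≠ y), f y = ∑ t ∈ T, ∑ k ∈ Finset.range n, f ((κ ^ k) t))
    {x₀ : ι} (hx₀ : ∀ k, 0 < k → k < n → (π ^ k) x₀ ≠ x₀) {s : ℕ} (hs0 : 0 < s) (hsn : s < n) :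
    ∑ t ∈ T, ∑ k ∈ Finset.range n, H x₀ ((κ ^ k) t) * H x₀ ((κ ^ (k + s)) t) =
      -((univ.filter fun y => κ y = y).card : ℤ) := by
  -- the partner row `x₁ = π^(n-s) x₀`
  have hback : (π ^ s) ((π ^ (n - s)) x₀) = x₀ := by
    rw [← Equiv.Perm.mul_apply, ← pow_add, show s + (n - s) = n by omega, hπ, Equiv.Perm.one_apply]
  have hne : (π ^ (n - s)) x₀ ≠ x₀ := hx₀ (n - s) (by omega) (by omega)
  have hkey : ∀ j, H x₀ ((κ ^ s) j) = H ((π ^ (n - s)) x₀) j := by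
    intro j
    conv_lhs => rw [← hback]
    exact perm_aut_pow hinv s _ _
  have h1 : ∀ t ∈ T, ∑ k ∈ Finset.range n, H x₀ ((κ ^ k) t) * H x₀ ((κ ^ (k + s)) t) =
      ∑ k ∈ Finset.range n, H x₀ ((κ ^ k) t) * H ((π ^ (n - s)) x₀) ((κ ^ k) t) := by
    intro t _
    refine Finset.sum_congr rfl fun k _ => ?_
    rw [add_comm, pow_add, Equiv.Perm.mul_apply, hkey]
  rw [Finset.sum_congr rfl h1, ← hT (fun y => H x₀ y * H ((π ^ (n - s)) x₀) y)]
  -- full inner product = fixed part + moved part = 0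
  have horth : ∑ y, H x₀ y * H ((π ^ (n - s)) x₀) y = 0 := hadamard_row_orth H hH (Ne.symm hne)
  rw [← Finset.sum_filter_add_sum_filter_not univ (fun y => κ y = y)] at horth
  -- fixed part: the two rows agree on a fixed column
  have hfix : ∑ y ∈ univ.filter (fun y => κ y = y), H x₀ y * H ((π ^ (n - s)) x₀) y =
      ((univ.filter fun y => κ y = y).card : ℤ) := by
    rw [Finset.card_eq_sum_ones, Nat.cast_sum, Nat.cast_one]
    refine Finset.sum_congr rfl fun y hy => ?_
    have hyf : κ y = y := (Finset.mem_filter.mp hy).2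
    rw [← hkey, perm_pow_apply_of_fixed κ hyf s]
    exact pm_mul_self (hH.1 x₀ y)
  rw [hfix] at horth
  linarith

/-! ### reading the identity on `ZMod n` -/

omit [DecidableEq ι] [Fintype ι] in
/-- `κ ^ (m % n) = κ ^ m` when `κ ^ n = 1` -/
lemma pow_mod_of_pow_eq_one (κ : Equiv.Perm ι) {n : ℕ} (hκ : κ ^ n = 1) (m : ℕ) : κ ^ (m % n) = κ ^ m := by
  conv_rhs => rw [← Nat.div_add_mod m n, pow_add, pow_mul, hκ, one_pow, one_mul]

omit [Fintype ι] [DecidableEq ι] in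
/-- sums over `ZMod n` through `val` are sums over `range n` -/
lemma sum_zmod_val_eq_sum_range {n : ℕ} [NeZero n] (F : ℕ → ℤ) :
    ∑ t : ZMod n, F t.val = ∑ k ∈ Finset.range n, F k := by
  have himg : (Finset.univ : Finset (ZMod n)).image ZMod.val = Finset.range n := by
    ext k
    rw [Finset.mem_image, Finset.mem_range]
    constructor
    · rintro ⟨t, -, rfl⟩; exact ZMod.val_lt t
    · intro hk; exact ⟨(k : ZMod n), Finset.mem_univ _, ZMod.val_cast_of_lt hk⟩
  rw [← himg, Finset.sum_image fun a _ b _ h => ZMod.val_injective n h]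

/-- a nonzero residue has `0 < val < n` -/
lemma zmod_val_pos_of_ne_zero {n : ℕ} [NeZero n] {s : ZMod n} (hs : s ≠ 0) : 0 < s.val ∧ s.val < n :=
  ⟨Nat.pos_of_ne_zero fun h => hs ((ZMod.val_eq_zero s).mp h), ZMod.val_lt s⟩

/-- **The sequence family of a free row (permutation pair).**  Under the hypotheses of `cyclicCore_paf_identity`, with every
moved column free of period `n` and `κ ^ n = 1`: there are a transversal `T` (`n·|T| = #moved columns`) and `±1` sequences
`a_y : ZMod n → ℤ` (`y ∈ T`; namely `t ↦ H x₀ (κ^t y)`) with `Σ_{y∈T} PAF (a_y) s = −#Fix κ` for every `s ≠ 0`. -/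
theorem exists_paf_family {H : Matrix ι ι ℤ} (hH : IsHadamardMatrix H) {π κ : Equiv.Perm ι}
    (hinv : ∀ i j, H (π i) (κ j) = H i j) {n : ℕ} [NeZero n] (hπ : π ^ n = 1) (hκ : κ ^ n = 1)
    (hfree : ∀ y, κ y ≠ y → ∀ k, 0 < k → k < n → (κ ^ k) y ≠ y)
    {x₀ : ι} (hx₀ : ∀ k, 0 < k → k < n → (π ^ k) x₀ ≠ x₀) :
    ∃ T : Finset ι, n * T.card = (univ.filter fun y => κ y ≠ y).card ∧
      ∃ a : {y // y ∈ T} → ZMod n → ℤ, (∀ y, IsPM (a y)) ∧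
        ∀ s : ZMod n, s ≠ 0 → ∑ y, PAF (a y) s = -((univ.filter fun y => κ y = y).card : ℤ) := by
  have hn : 0 < n := Nat.pos_of_ne_zero (NeZero.ne n)
  set Y := univ.filter fun y => κ y ≠ y with hY
  have hstab : ∀ y ∈ Y, κ y ∈ Y := by
    intro y hy
    rw [hY, Finset.mem_filter] at hy ⊢
    exact ⟨Finset.mem_univ _, fun h => hy.2 (κ.injective h)⟩
  have hper : ∀ y ∈ Y, (κ ^ n) y = y := fun y _ => by rw [hκ, Equiv.Perm.one_apply]
  have hfreeY : ∀ y ∈ Y, ∀ k, 0 < k → k < n → (κ ^ k) y ≠ y :=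
    fun y hy => hfree y (Finset.mem_filter.mp hy).2
  obtain ⟨T, -, hTcard, hTsum⟩ := exists_free_transversal κ hn Y.card Y le_rfl hstab hper hfreeY
  refine ⟨T, hTcard, fun y t => H x₀ ((κ ^ t.val) y.1), fun y t => hH.1 _ _, fun s hs => ?_⟩
  obtain ⟨hs0, hsn⟩ := zmod_val_pos_of_ne_zero hs
  have hid := cyclicCore_paf_identity hH hinv hπ T hTsum hx₀ hs0 hsn
  rw [← hid, ← Finset.sum_coe_sort T]
  refine Finset.sum_congr rfl fun y _ => ?_
  unfold PAF
  have hterm : ∀ t : ZMod n, H x₀ ((κ ^ t.val) y.1) * H x₀ ((κ ^ (t + s).val) y.1) =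
      H x₀ ((κ ^ t.val) y.1) * H x₀ ((κ ^ (t.val + s.val)) y.1) := by
    intro t
    rw [ZMod.val_add, pow_mod_of_pow_eq_one κ hκ]
  simp only [hterm]
  exact sum_zmod_val_eq_sum_range (fun k => H x₀ ((κ ^ k) y.1) * H x₀ ((κ ^ (k + s.val)) y.1))

/-- **The sequence family of a free row (signed automorphism of odd order).**  `H` Hadamard with a SIGNED automorphism
`(π, κ, d, e)`, `π ^ n = κ ^ n = 1`, `n` odd, every moved column free of period `n`, `x₀` a free row: after re-signing along the
cycles (`exists_resign_of_odd`) the previous theorem applies, so there are `T` with `n·|T| = #moved columns` and `±1` sequences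
`a_y` (`y ∈ T`) on `ZMod n` with `Σ_{y∈T} PAF (a_y) s = −#Fix κ` for all `s ≠ 0`. -/
theorem exists_paf_family_signed {H : Matrix ι ι ℤ} (hH : IsHadamardMatrix H) {π κ : Equiv.Perm ι} {d e : ι → ℤ}
    (haut : IsSignedAut H π κ d e) {n : ℕ} [NeZero n] (hodd : Odd n) (hπ : π ^ n = 1) (hκ : κ ^ n = 1)
    (hfree : ∀ y, κ y ≠ y → ∀ k, 0 < k → k < n → (κ ^ k) y ≠ y)
    {x₀ : ι} (hx₀ : ∀ k, 0 < k → k < n → (π ^ k) x₀ ≠ x₀) :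
    ∃ T : Finset ι, n * T.card = (univ.filter fun y => κ y ≠ y).card ∧
      ∃ a : {y // y ∈ T} → ZMod n → ℤ, (∀ y, IsPM (a y)) ∧
        ∀ s : ZMod n, s ≠ 0 → ∑ y, PAF (a y) s = -((univ.filter fun y => κ y = y).card : ℤ) := by
  obtain ⟨σ, τ, -, -, hH', hinv⟩ := exists_resign_of_odd hH haut hodd hπ hκ
  have hinv' : ∀ i j, (Matrix.of fun i j => σ i * τ j * H i j) (π i) (κ j) =
      (Matrix.of fun i j => σ i * τ j * H i j) i j := fun i j => by
    simp only [Matrix.of_apply]; exact hinv i j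
  exact exists_paf_family hH' hinv' hπ hκ hfree hx₀

end Summit.Ventures.DiscreteObjects.Hadamard
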